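/-
Copyright (c) 2026. All rights reserved.
Released under Apache 2.0 license as described in the file LICENSE.
Authors: HodgeCM publication cell (pub-hodgecm), GR lane, seat GR-2 (`pub-hodgecm-own-hyp34`).
-/
import Literature.NumberTheory.Weil1964.ArchActQuadraticPlaces
import Literature.NumberTheory.Automorphic.UnitaryGroupArchRealPair
import HarnessLib

/-!
# The archimedean symplectic action at a real place of `F` SPLIT in `E`: reading `𝔸_E` at a pair of real places

Twin of `ArchActQuadraticComplexPlaces` (complex places of `F`) for the place type (ii) of the general-`E/F`
programme: a REAL place `v` of `F` under a REAL place `w` of `E` (then `c • w ≠ w` is the other place over `v`,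
`E ⊗_F F_v = E_w × E_{cw} = ℝ × ℝ`, `δ ⊗ 1 = (s, −s)`, `s = σ_w(δ) ∈ ℝ`; a CM extension has no such place).
For the unitary group `U(J)(𝔸_F)`, `J = T ⊗ 1`, `T ∈ GLₙ(F)` symmetric, embedded in `Sp(W_𝔸)` by restriction of
scalars in the quadratic coordinates `1, δ` (`UnitaryGroupSymplecticCarriers`), and `g ∈ U(J)(E ⊗ ℝ)`:

* §1 `adeleAtR w : 𝔸_E →+* ℝ` (`Y ↦ σ_w(Y_w)` at a real `w`), `adeleAtRR w = (adeleAtR w, adeleAtR (cw))`; on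
  archimedean matrices `(g, 1)` the pair-reading is `evalRR` (`map_adeleAtRR_coe_archToAdelic`); the local quadratic
  coordinates read at the pair: `adeleAtRR_quadraticAdeleEquiv_archVec`, `splitReal_quadraticAdeleEquiv_symm`
  (no coordinate twist: real embeddings are unique, `extensionEmbedding_toInfPlace_of_isReal`);
* §2 the **CORE** `placeVec_piArch_resEnd_realSplit`: the `v`-slices of the archimedean coordinates of
  `Res_{𝔸_E/𝔸_F} G` on an archimedean pair `(a, b)` are the split-real restriction of scalars
  (`ArchSplitRealPlaceSection.isQuadraticCoordinates_splitReal`) of `G.map (adeleAtRR w)` on `(a_v, b_v)`;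
* §3 through the unitary carriers: **`placeVec_archAct_archToAdelic_realSplit`** — the `v`-slices of
  `archAct 𝕋 (ι_𝔸 (g, 1)) (a, b)` are `toSymplectic (archAtRealSplit w g) (a_v, b_v)`, `archAtRealSplit` the
  `(w, cw)`-factor `U(swap, σ_v(T) ⊗ 1)(ℝ × ℝ) ≅ GL_N(ℝ)` of `UnitaryGroupArchRealPair` — the `v`-component of the
  archimedean Weil section at a type-(ii) place acts through the split Levi (`archSectionRealSplit`).

Topic `NumberTheory/Weil1964`; KERNEL only: two `RingHom` definitions and theorems; no `def … : Prop`, no named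
fact, no `sorry`.  Written for the stage-1 cell `pub-hodgecm` (GR lane); nothing here is a claim of the manuscripts
adjudicated by that cell.

## References
* J. W. S. Cassels, A. Fröhlich (eds.), *Algebraic Number Theory* (1967), Ch. II §14 [CasselsFrohlichANT1967].
* C. Mœglin, M.-F. Vignéras, J.-L. Waldspurger, LNM 1291 (1987), Chap. 1 I.17 [MoeglinVignerasWaldspurger1987].
* S. Gelbart, J. Rogawski, Invent. Math. 105 (1991), §3.1 p. 454 [GelbartRogawski1991].
* A. Borel, H. Jacquet, Proc. Sympos. Pure Math. 33.1 (1979), §4.1 [BorelJacquet1979].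
-/

set_option autoImplicit false

noncomputable section

open scoped Matrix
open NumberField NumberField.InfinitePlace NumberField.mixedEmbedding IsDedekindDomain

namespace Literature.NumberTheory.Weil1964

open Literature.NumberTheory.Automorphic Literature.NumberTheory.Automorphic.UnitaryGroup QuadraticCoordinates

/-! ## §1 Reading an adele of `E` at a real place and at the pair `(w, cw)` -/

section Core

variable (F : Type) [Field F] [NumberField F] (E : Type) [Field E] [NumberField E] [Algebra F E]
  (c : E ≃ₐ[F] E) (hcc : c * c = 1) (n : Type) [Fintype n] [DecidableEq n]
  (v : {v : InfinitePlace F // v.IsReal}) (w : {w : InfinitePlace E // w.IsReal})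
  (hover : w.1.comap (algebraMap F E) = v.1)

/-- **`adeleAtR w : 𝔸_E →+* ℝ`**, `Y ↦ σ_w(Y_w)` — an adele of `E` read at the REAL place `w`.
[cite: CasselsFrohlichANT1967, Ch. II §14] -/
def adeleAtR (w : {w : InfinitePlace E // w.IsReal}) : AdeleRing (𝓞 E) E →+* ℝ :=
  (Completion.extensionEmbeddingOfIsReal w.2).comp
    ((Pi.evalRingHom (fun w : InfinitePlace E => w.Completion) w.1).comp
      (RingHom.fst (InfiniteAdeleRing E) (FiniteAdeleRing (𝓞 E) E)))

omit [NumberField F] [Algebra F E] in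
/-- formula. [cite: CasselsFrohlichANT1967, Ch. II §14] -/
@[simp] theorem adeleAtR_apply (w : {w : InfinitePlace E // w.IsReal}) (Y : AdeleRing (𝓞 E) E) :
    adeleAtR E w Y = Completion.extensionEmbeddingOfIsReal w.2 (Y.1 w.1) := rfl

omit [NumberField F] [NumberField E] in
/-- the partner `c w` lies over the same place of `F`. [cite: PlatonovRapinchuk1994, §3.2] -/
theorem comap_cPlace : (cPlace F E c w).1.comap (algebraMap F E) = w.1.comap (algebraMap F E) := by
  rw [coe_cPlace, comap_smul]
  congr 1
  exact RingHom.ext fun t => c.symm.commutes t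

/-- **`adeleAtRR w : 𝔸_E →+* ℝ × ℝ`**, `Y ↦ (σ_w(Y_w), σ_{cw}(Y_{cw}))` — an adele of `E` read at the pair `(w, cw)`.
[cite: CasselsFrohlichANT1967, Ch. II §14] -/
def adeleAtRR : AdeleRing (𝓞 E) E →+* ℝ × ℝ := (adeleAtR E w).prod (adeleAtR E (cPlace F E c w))

omit [NumberField F] in
/-- formula. [cite: CasselsFrohlichANT1967, Ch. II §14] -/
@[simp] theorem adeleAtRR_apply (Y : AdeleRing (𝓞 E) E) :
    adeleAtRR F E c w Y = (adeleAtR E w Y, adeleAtR E (cPlace F E c w) Y) := rfl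

/-- an archimedean matrix `(g, 1)` read at a real place `w'`: `σ_{w'}(((g,1)ᵢⱼ)_{w'}) = (gᵢⱼ)_{w'}`.
[cite: BorelJacquet1979, §4.1] -/
theorem adeleAtR_coe_archToAdelic {N : ℕ} (J : Matrix (Fin N) (Fin N) E) (w' : {w : InfinitePlace E // w.IsReal})
    (g : arch F E c N J) (i j : Fin N) :
    adeleAtR E w' ((((archToAdelic F E c N J g).1 : GL (Fin N) (AdeleRing (𝓞 E) E)) :
        Matrix (Fin N) (Fin N) (AdeleRing (𝓞 E) E)) i j) =
      ((((g : GL (Fin N) (mixedSpace E)) : Matrix (Fin N) (Fin N) (mixedSpace E)) i j).1 w') := by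
  have hu : ((archToAdelic F E c N J g).1 : GL (Fin N) (AdeleRing (𝓞 E) E)) =
      GLn.ofInfinite N E (g : GL (Fin N) (mixedSpace E)) := rfl
  rw [hu, GLn.coe_ofInfinite_apply, adeleAtR_apply]
  exact congrArg (fun y : mixedSpace E => y.1 w')
    ((InfiniteAdeleRing.ringEquiv_mixedSpace E).apply_symm_apply
      ((((g : GL (Fin N) (mixedSpace E)) : Matrix (Fin N) (Fin N) (mixedSpace E)) i j)))

/-- **on archimedean matrices `(g, 1)` the pair-reading is `evalRR`**: `(g, 1).map (adeleAtRR w) = g.map (evalRR w)`.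
[cite: BorelJacquet1979, §4.1] -/
theorem map_adeleAtRR_coe_archToAdelic {N : ℕ} (J : Matrix (Fin N) (Fin N) E) (g : arch F E c N J) :
    ((((archToAdelic F E c N J g).1 : GL (Fin N) (AdeleRing (𝓞 E) E)) :
        Matrix (Fin N) (Fin N) (AdeleRing (𝓞 E) E))).map (adeleAtRR F E c w) =
      (((g : GL (Fin N) (mixedSpace E)) : Matrix (Fin N) (Fin N) (mixedSpace E))).map (evalRR F E c w) := by
  refine Matrix.ext fun i j => ?_
  rw [Matrix.map_apply, Matrix.map_apply, adeleAtRR_apply, evalRR_apply]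
  exact Prod.ext (adeleAtR_coe_archToAdelic F E c J w g i j) (adeleAtR_coe_archToAdelic F E c J (cPlace F E c w) g i j)

variable [Algebra.IsQuadraticExtension F E]
variable {δ : E} (hcδ : c δ = -δ) (hδ : δ ≠ 0) {d : F} (hd : δ * δ = algebraMap F E d)

/-- **`σ_{w'} ((Ψ_v p)_{w'}) = σ_v p₁ + σ_v p₂ · σ_{w'}(δ)`** for a REAL `w' ∣ v` (real embeddings are unique: no twist).
[cite: CasselsFrohlichANT1967, Ch. II §14] -/
theorem extensionEmbeddingOfIsReal_quadraticInfLocalEquiv (hδF : δ ∉ Set.range (algebraMap F E))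
    (w' : {w : InfinitePlace E // w.IsReal}) (hw' : w'.1.comap (algebraMap F E) = v.1) (p : v.1.Completion × v.1.Completion) :
    Completion.extensionEmbeddingOfIsReal w'.2 (quadraticInfLocalEquiv E v.1 hδF p ⟨w'.1, hw'⟩) =
      Completion.extensionEmbeddingOfIsReal v.2 p.1 + Completion.extensionEmbeddingOfIsReal v.2 p.2 * embedding_of_isReal w'.2 δ := by
  apply Complex.ofReal_injective
  change ((Completion.extensionEmbeddingOfIsReal w'.2 (quadraticInfLocalMap E v.1 δ p ⟨w'.1, hw'⟩) : ℝ) : ℂ) = _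
  rw [Completion.extensionEmbeddingOfIsReal_apply, quadraticInfLocalMap_apply_apply, map_add, map_mul,
    extensionEmbedding_toInfPlace_of_isReal F E v.1 v.2 ⟨w'.1, hw'⟩,
    extensionEmbedding_toInfPlace_of_isReal F E v.1 v.2 ⟨w'.1, hw'⟩,
    Completion.extensionEmbedding_coe, Complex.ofReal_add, Complex.ofReal_mul, embedding_of_isReal_apply]
  rfl

omit [Fintype n] [DecidableEq n] in
include hover in
/-- **`adeleAtRR w` of `Ψ_𝔸 (archVec a, archVec b)_i` is `splitRealCoords s (a_{i,v}, b_{i,v})`**, `s = σ_w δ`.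
[cite: CasselsFrohlichANT1967, Ch. II §14] -/
theorem adeleAtRR_quadraticAdeleEquiv_archVec (a b : n → mixedSpace F) (i : n) :
    adeleAtRR F E c w (quadraticAdeleEquiv F E c hcδ hδ (archVec F n a i, archVec F n b i)) =
      splitRealCoords (embedding_of_isReal w.2 δ) (embedding_of_isReal_ne_zero E w hδ)
        (placeVec F n v a i, placeVec F n v b i) := by
  -- the base change of an archimedean vector read at a real place `w'` over `v`
  have hbc : ∀ (w' : {w : InfinitePlace E // w.IsReal}) (hw' : w'.1.comap (algebraMap F E) = v.1)
      (x : n → mixedSpace F),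
      Completion.extensionEmbeddingOfIsReal w'.2 ((AdeleRing.baseChange F E (archVec F n x i)).1 w'.1) = placeVec F n v x i := by
    intro w' hw' x
    apply Complex.ofReal_injective
    rw [Completion.extensionEmbeddingOfIsReal_apply, AdeleRing.baseChange_fst,
      infiniteAdele_baseChange_apply_placesOver E v.1 (archVec F n x i).1 ⟨w'.1, hw'⟩,
      extensionEmbedding_toInfPlace_of_isReal F E v.1 v.2 ⟨w'.1, hw'⟩]
    have e1 := congrArg (fun y : mixedSpace F => y.1 v)
      ((InfiniteAdeleRing.ringEquiv_mixedSpace F).apply_symm_apply (x i))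
    exact congrArg _ e1
  have hδw : ∀ w' : {w : InfinitePlace E // w.IsReal},
      adeleAtR E w' (algebraMap E (AdeleRing (𝓞 E) E) δ) = embedding_of_isReal w'.2 δ := by
    intro w'
    rw [adeleAtR_apply, AdeleRing.algebraMap_fst_apply]
    exact Completion.extensionEmbeddingOfIsReal_coe w'.2 (WithAbs.toAbs w'.1.1 δ)
  simp only [adeleAtRR_apply, splitRealCoords_apply, quadraticAdeleEquiv_apply]
  refine Prod.ext ?_ ?_
  · show adeleAtR E w _ = _
    rw [map_add, map_mul, hδw, adeleAtR_apply, adeleAtR_apply, hbc w hover, hbc w hover]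
  · show adeleAtR E (cPlace F E c w) _ = _
    rw [map_add, map_mul, hδw, adeleAtR_apply, adeleAtR_apply, hbc (cPlace F E c w) ((comap_cPlace F E c w).trans hover),
      hbc (cPlace F E c w) ((comap_cPlace F E c w).trans hover), embedding_of_isReal_cPlace_delta F E c w hcδ, mul_neg,
      sub_eq_add_neg]

omit [Fintype n] [DecidableEq n] in
include hover in
/-- **the `v`-coordinates of `Ψ_𝔸⁻¹ Y`, read in `ℝ`, are `splitRealCoords⁻¹ (adeleAtRR w Y)`.**
[cite: CasselsFrohlichANT1967, Ch. II §14] -/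
theorem splitReal_quadraticAdeleEquiv_symm (Y : AdeleRing (𝓞 E) E) :
    (Completion.extensionEmbeddingOfIsReal v.2 (((quadraticAdeleEquiv F E c hcδ hδ).symm Y).1.1 v.1),
      Completion.extensionEmbeddingOfIsReal v.2 (((quadraticAdeleEquiv F E c hcδ hδ).symm Y).2.1 v.1)) =
      (splitRealCoords (embedding_of_isReal w.2 δ) (embedding_of_isReal_ne_zero E w hδ)).symm (adeleAtRR F E c w Y) := by
  have hδF : δ ∉ Set.range (algebraMap F E) := not_mem_range_algebraMap_of_apply_eq_neg E c hcδ hδ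
  rw [AddEquiv.eq_symm_apply]
  set p : v.1.Completion × v.1.Completion := (quadraticInfLocalEquiv E v.1 hδF).symm fun w' => Y.1 w'.1 with hp_def
  have hp : ((((quadraticAdeleEquiv F E c hcδ hδ).symm Y).1.1 v.1),
      (((quadraticAdeleEquiv F E c hcδ hδ).symm Y).2.1 v.1)) = p := by
    rw [hp_def, ← quadraticInfiniteAdeleEquiv_symm_apply_local E hδF Y.1 v.1]
    exact congrArg (fun q : InfiniteAdeleRing F × InfiniteAdeleRing F => (q.1 v.1, q.2 v.1))
      (quadraticAdeleEquiv_symm_fst E c hcδ hδ Y)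
  have h1 : (((quadraticAdeleEquiv F E c hcδ hδ).symm Y).1.1 v.1) = p.1 := congrArg Prod.fst hp
  have h2 : (((quadraticAdeleEquiv F E c hcδ hδ).symm Y).2.1 v.1) = p.2 := congrArg Prod.snd hp
  rw [h1, h2]
  -- `σ_{w'}(Y_{w'}) = σ_{w'}((Ψ_v p)_{w'})` at both real places over `v`
  have hY : ∀ (w' : {w : InfinitePlace E // w.IsReal}) (hw' : w'.1.comap (algebraMap F E) = v.1),
      Completion.extensionEmbeddingOfIsReal w'.2 (Y.1 w'.1) =
        Completion.extensionEmbeddingOfIsReal v.2 p.1 + Completion.extensionEmbeddingOfIsReal v.2 p.2 * embedding_of_isReal w'.2 δ := by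
    intro w' hw'
    have h3 : (quadraticInfLocalEquiv E v.1 hδF p) ⟨w'.1, hw'⟩ = Y.1 w'.1 := by
      rw [hp_def, ContinuousLinearEquiv.apply_symm_apply]
    rw [← h3]
    exact extensionEmbeddingOfIsReal_quadraticInfLocalEquiv F E v hδF w' hw' p
  simp only [adeleAtRR_apply, splitRealCoords_apply, adeleAtR_apply]
  refine Prod.ext ?_ ?_
  · exact (hY w hover).symm
  · show _ = Completion.extensionEmbeddingOfIsReal (cPlace F E c w).2 (Y.1 (cPlace F E c w).1)
    rw [hY (cPlace F E c w) ((comap_cPlace F E c w).trans hover), embedding_of_isReal_cPlace_delta F E c w hcδ, mul_neg,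
      sub_eq_add_neg]

/-! ## §2 The CORE at a split real place -/

include hover in
/-- **CORE — restriction of scalars `E/F` on `𝔸_E`-matrices read at the pair `(w, cw)` of REAL places over `v`.**
For `G ∈ Mₙ(𝔸_E)` the `v`-slices of the archimedean coordinates of `Res_{𝔸_E/𝔸_F} G` on an archimedean pair
`(a, b)` are the split-real restriction of scalars of `G.map (adeleAtRR w)` on the slices `(a_v, b_v)`.
[cite: CasselsFrohlichANT1967, Ch. II §14; GelbartRogawski1991, §3.1 p. 454] -/
theorem placeVec_piArch_resEnd_realSplit (G : Matrix n n (AdeleRing (𝓞 E) E)) (a b : n → mixedSpace F) :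
    (placeVec F n v (piArch F n ((isQuadraticCoordinates_adele E c hcδ hδ hd).resEnd n G (archVec F n a, archVec F n b)).1),
      placeVec F n v (piArch F n ((isQuadraticCoordinates_adele E c hcδ hδ hd).resEnd n G (archVec F n a, archVec F n b)).2)) =
      (isQuadraticCoordinates_splitReal (embedding_of_isReal w.2 δ) (embedding_of_isReal_ne_zero E w hδ)).resEnd n
        (G.map (adeleAtRR F E c w)) (placeVec F n v a, placeVec F n v b) := by
  set Ψ : (AdeleRing (𝓞 F) F × AdeleRing (𝓞 F) F) ≃+ AdeleRing (𝓞 E) E :=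
    (quadraticAdeleEquiv F E c hcδ hδ).toAddEquiv with hΨ
  set cc : (ℝ × ℝ) ≃+ (ℝ × ℝ) :=
    splitRealCoords (embedding_of_isReal w.2 δ) (embedding_of_isReal_ne_zero E w hδ) with hcc'
  set z : n → AdeleRing (𝓞 E) E := fun i => Ψ (archVec F n a i, archVec F n b i) with hz_def
  set zc : n → ℝ × ℝ := fun i => cc (placeVec F n v a i, placeVec F n v b i) with hzc_def
  have h1 : (isQuadraticCoordinates_adele E c hcδ hδ hd).resEnd n G (archVec F n a, archVec F n b) =
      reIm Ψ n (G *ᵥ z) := by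
    rw [← (isQuadraticCoordinates_adele E c hcδ hδ hd).resEnd_reIm]
    exact congrArg _ ((reIm Ψ n).apply_symm_apply _).symm
  have h2 : (isQuadraticCoordinates_splitReal (embedding_of_isReal w.2 δ) (embedding_of_isReal_ne_zero E w hδ)).resEnd n
      (G.map (adeleAtRR F E c w)) (placeVec F n v a, placeVec F n v b) =
      reIm cc n (G.map (adeleAtRR F E c w) *ᵥ zc) := by
    rw [← (isQuadraticCoordinates_splitReal (embedding_of_isReal w.2 δ) (embedding_of_isReal_ne_zero E w hδ)).resEnd_reIm]
    exact congrArg _ ((reIm cc n).apply_symm_apply _).symm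
  have hz : ∀ i, adeleAtRR F E c w (z i) = zc i := fun i =>
    adeleAtRR_quadraticAdeleEquiv_archVec F E c n v w hover hcδ hδ a b i
  have hGz : ∀ j, adeleAtRR F E c w ((G *ᵥ z) j) = (G.map (adeleAtRR F E c w) *ᵥ zc) j := by
    intro j
    rw [RingHom.map_mulVec]
    congr 1
    funext i
    exact hz i
  have hloc := fun Y => splitReal_quadraticAdeleEquiv_symm F E c v w hover hcδ hδ Y
  rw [h1, h2]
  refine Prod.ext (funext fun j => ?_) (funext fun j => ?_)
  · change Completion.extensionEmbeddingOfIsReal v.2 (((quadraticAdeleEquiv F E c hcδ hδ).symm ((G *ᵥ z) j)).1.1 v.1)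
      = (cc.symm ((G.map (adeleAtRR F E c w) *ᵥ zc) j)).1
    rw [← hGz j, ← hloc]
  · change Completion.extensionEmbeddingOfIsReal v.2 (((quadraticAdeleEquiv F E c hcδ hδ).symm ((G *ᵥ z) j)).2.1 v.1)
      = (cc.symm ((G.map (adeleAtRR F E c w) *ᵥ zc) j)).2
    rw [← hGz j, ← hloc]

end Core

/-! ## §3 Through the unitary carrier maps -/

section Unitary

variable (F : Type) [Field F] [NumberField F] (E : Type) [Field E] [NumberField E] [Algebra F E]
  [Algebra.IsQuadraticExtension F E] (c : E ≃ₐ[F] E) (hcc : c * c = 1) (N : ℕ)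
  {δ : E} (hcδ : c δ = -δ) (hδ : δ ≠ 0) {d : F} (hd : δ * δ = algebraMap F E d)
  {T : Matrix (Fin N) (Fin N) F} (hT : T.IsSymm) {J : Matrix (Fin N) (Fin N) E} (hJ : J = T.map (algebraMap F E))
  (v : {v : InfinitePlace F // v.IsReal}) (w : {w : InfinitePlace E // w.IsReal})
  (hover : w.1.comap (algebraMap F E) = v.1)

include hover in
/-- **(α) `ι_𝔸` at a split real place of `F`.** For `u ∈ U(J)(𝔸_F)` (`J = T ⊗ 1`) the `v`-slices of
`archAct (ι_𝔸 u)` are the split-real restriction of scalars of `u_{w,cw} = u.map (adeleAtRR w)`.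
[cite: GelbartRogawski1991, §3.1 p. 454] -/
theorem placeVec_archAct_adelicToSymplectic_realSplit (u : adelic F E c N J) (a b : Fin N → mixedSpace F) :
    (placeVec F (Fin N) v (archAct (T.map (algebraMap F (AdeleRing (𝓞 F) F)))
        (adelicToSymplectic F E c N hcδ hδ hd hT hJ u) (a, b)).1,
      placeVec F (Fin N) v (archAct (T.map (algebraMap F (AdeleRing (𝓞 F) F)))
        (adelicToSymplectic F E c N hcδ hδ hd hT hJ u) (a, b)).2) =
      (isQuadraticCoordinates_splitReal (embedding_of_isReal w.2 δ) (embedding_of_isReal_ne_zero E w hδ)).resEnd (Fin N)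
        (((u : GL (Fin N) (AdeleRing (𝓞 E) E)) : Matrix (Fin N) (Fin N) (AdeleRing (𝓞 E) E)).map (adeleAtRR F E c w))
        (placeVec F (Fin N) v a, placeVec F (Fin N) v b) :=
  placeVec_piArch_resEnd_realSplit F E c (Fin N) v w hover hcδ hδ hd
    ((u : GL (Fin N) (AdeleRing (𝓞 E) E)) : Matrix (Fin N) (Fin N) (AdeleRing (𝓞 E) E)) a b

include hover in
/-- **(β) `ι_𝔸 (g, 1)` at a split real place of `F` IS `toSymplectic` of the `(w, cw)`-factor.**  For
`g ∈ U(J)(F ⊗ ℝ)` the `v`-slices of `archAct (ι_𝔸 (g, 1))` are the symplectic embedding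
`toSymplectic : U(swap, σ_v(T) ⊗ 1)(ℝ × ℝ) → Sp((ℝᴺ)², polar β_{σ_v(T)})` (quadratic coordinates `1, (s, -s)`,
`s = σ_w δ`) of `archAtRealSplit w g`, applied to `(a_v, b_v)`.
[cite: GelbartRogawski1991, §3.1 p. 454; MoeglinVignerasWaldspurger1987, Chap. 1 I.17] -/
theorem placeVec_archAct_archToAdelic_realSplit (g : arch F E c N J) (a b : Fin N → mixedSpace F) :
    (placeVec F (Fin N) v (archAct (T.map (algebraMap F (AdeleRing (𝓞 F) F)))
        (adelicToSymplectic F E c N hcδ hδ hd hT hJ (archToAdelic F E c N J g)) (a, b)).1,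
      placeVec F (Fin N) v (archAct (T.map (algebraMap F (AdeleRing (𝓞 F) F)))
        (adelicToSymplectic F E c N hcδ hδ hd hT hJ (archToAdelic F E c N J g)) (a, b)).2) =
      ((isQuadraticCoordinates_splitReal (embedding_of_isReal w.2 δ) (embedding_of_isReal_ne_zero E w hδ)).toSymplectic (Fin N)
          (hT.map (realEmbOfPlace F E w)) swap_diag (swap_delta (embedding_of_isReal w.2 δ)) rfl
          (archAtRealSplit F E c N hcc w T hJ g)).1
        (placeVec F (Fin N) v a, placeVec F (Fin N) v b) := by
  rw [placeVec_archAct_adelicToSymplectic_realSplit F E c N hcδ hδ hd hT hJ v w hover, map_adeleAtRR_coe_archToAdelic,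
    IsQuadraticCoordinates.coe_toSymplectic, IsQuadraticCoordinates.resAut_apply, coe_archAtRealSplit]
  rfl

end Unitary

end Literature.NumberTheory.Weil1964

end
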